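/-
Copyright (c) 2026 the pub-hodgecm-mathlib formalisation cell (harness21).  Prover seat hodgecm-mathlib-K2Liu-p02 (g7), Track B «K2-LIT» ∕ hLiu418
#184♮, socket #41 open surface (u-0c) `K2LiuSiegelEisensteinMiddleTermPackageInstance` (LEAD F0P6-plan (g14) BATCH #49 (4)), file I1 letter (CENSUS-u0c §3 «THE
ONE MISSING LETTER»): the `Δ`-block of `w₀ · Λ(x) · w₀`.  THEOREMS ONLY (no `def`, no `instance`, no notation, no named-fact hypothesis, no `sorry`).
-/
import Summits.HodgeConjecture.HodgeConjecture.Theorems.K2LiuSiegelMiddleCellLeviCriterion   -- ★ α2d: frames of `w₀` and `Λ x`, `reflStd_inv`, `algebraMap_pattern_std`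
import HarnessLib

/-!
# Crux `HLiu418`, Road Φ, organ G5-a ∕ (u-0c) file I1 letter: THE `Δ`-BLOCK OF `w₀ · Λ(x) · w₀` — `x − (x − x♯)·diag(0,1)`, i.e. columns `(x·e₀ | x♯·e₁)`

Cell `hodgecm-mathlib`, crux item hLiu418 = `stmt-HodgeConjecture-24832`; squad K2 ∕ K2Liu, prover K2Liu-p02 (g7); count-neutral helper.
Namespace `Summit.HodgeConjecture.HodgeConjecture.Cruxes.HLiu418.K2LiuReflStdLeviConjDeltaBlock`.

THE POINT (CENSUS-u0c-MiddleTermPackageInstance §3).  The torus law of the inner section of the middle cell, `F(Λ(a)·y) = m(a)·σ_s(w₀Λ(a)w₀⁻¹)·F(y)`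
(★ (β0-1b) `inner_law_of_unfold`), needs the VALUE of the inducing character at `w₀ Λ(x) w₀` for Borel `x ∈ GL₂(𝔸_L)`, i.e. the `Δ`-block
`deltaBlock (w₀ Λ(x) w₀)` and its determinant.  In the frame `C = (1 0; 1 1)` of ★ `deltaBlock_eq_conj` the middle representative `w₀ = ι(1, g₀)` is
`(1 0; −2D 1−2D)`, `D = diag(0,1)` (★ `frame_iotaGG_signInvolution`), and `Λ(x)` is `(x ½(x−x♯); 0 x♯)`, `x♯ = T⁻¹ (x̄⁻¹)ᵀ T` (★ α2c `frame_levi_apply`); hence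
* §1 `toBlocks₁₁_frame_conj_levi` — generic: `((1 0; −N 1−N)·(x B; 0 x′)·(1 0; −N 1−N))₁₁ = x − B·N`;
* §2 **`deltaBlock_reflStd_conj_levi`** — `deltaBlock (w₀ · Λ x · w₀) = x − (x − x♯) · diag(0,1)` for EVERY `x ∈ GL₂(𝔸_L)` (no Siegel hypothesis): the first column of
  `x`, the second column of `x♯`; `detDelta_reflStd_conj_levi` — `det_Δ (w₀ Λ x w₀) = x₀₀ · x♯₁₁ − x♯₀₁ · x₁₀` (so `= x₀₀ · x♯₁₁` on the Siegel locus `x₁₀ = 0 = x♯₀₁`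
  of ★ `isSiegelDelta_reflStd_conj_levi_unip_iff`; for the torus `x = diag(d₀, d₁)` and diagonal `T`: `x♯ = diag(d̄₀⁻¹, d̄₁⁻¹)`, `det_Δ = d₀ · d̄₁⁻¹`).
[MoeglinWaldspurger1995, II.1.7; KudlaRallis1994, §2 (2.10)–(2.12); GelbartPiatetskishapiroRallis1987, Part A §§1–2.]

HONEST LABEL.  Count-neutral helper: `HC_CM` is proved only modulo the 7 printed citations (2 remaining named inputs: hLiu418 = `stmt-HodgeConjecture-24832`,
h413 = `stmt-HodgeConjecture-24833`) until rung 0 closes; closes no socket by itself.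
-/

set_option autoImplicit false
set_option linter.dupNamespace false -- the mandated namespace repeats `HodgeConjecture.HodgeConjecture`

noncomputable section

open scoped Matrix
open NumberField IsDedekindDomain
open Literature.NumberTheory.Automorphic Literature.NumberTheory.Automorphic.UnitaryGroup Literature.NumberTheory.GaloisRepresentations
open Literature.NumberTheory.GelbartRogawski1991 Literature.NumberTheory.GelbartRogawski1991.GRConstruction
open Literature.NumberTheory.K2Lit.SiegelDoubled
open Literature.NumberTheory.GelbartRogawski1991.AdaptedBlocks
open UnitaryDualPair
open Summit.HodgeConjecture.HodgeConjecture.Cruxes.HLiu418.K2LiuSiegelDoubledRationalFrames (frame_iotaGG_signInvolution)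
open Summit.HodgeConjecture.HodgeConjecture.Cruxes.HLiu418.K2LiuSiegelRationalLeviDecomposition (frame_levi_apply)
open Summit.HodgeConjecture.HodgeConjecture.Cruxes.HLiu418.K2LiuSiegelMiddleCellLeviCriterion (algebraMap_pattern_std)

namespace Summit.HodgeConjecture.HodgeConjecture.Cruxes.HLiu418.K2LiuReflStdLeviConjDeltaBlock

/-! ## §1 Frame algebra -/

section Frame

variable {R : Type*} [CommRing R] {m : Type*} [Fintype m] [DecidableEq m]

/-- **the `Δ`-block of `W · (x B; 0 x′) · W` for the frame `W = (1 0; −N, 1 − N)` of `w₀` is `x − B·N`.** [cite: GelbartPiatetskishapiroRallis1987, Part A §1] -/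
theorem toBlocks₁₁_frame_conj_levi (N x B x' : Matrix m m R) :
    (Matrix.fromBlocks (1 : Matrix m m R) 0 (-N) (1 - N) * Matrix.fromBlocks x B 0 x' * Matrix.fromBlocks 1 0 (-N) (1 - N)).toBlocks₁₁ = x - B * N := by
  rw [Matrix.fromBlocks_multiply, Matrix.fromBlocks_multiply, Matrix.toBlocks_fromBlocks₁₁]
  simp only [Matrix.one_mul, Matrix.mul_one, Matrix.zero_mul, add_zero, Matrix.mul_neg]
  abel

end Frame

/-! ## §2 The `Δ`-block of `w₀ · Λ(x) · w₀` at the K2Liu datum (`n = 2`) -/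

section Doubled

variable (L : Type) [Field L] [NumberField L] [IsCMField L]
variable {N M : ℕ} (e : Fin N × Fin M ≃ Fin 2)
  (dV : Fin N → L) (hdV : ∀ i, IsCMField.complexConj L (dV i) = dV i)
  (dW : Fin M → L) (hdW : ∀ i, IsCMField.complexConj L (dW i) = dW i)

variable {g₀ : UnitaryGroup.rationalPair (Fp L) L (IsCMField.complexConj L) N M (Matrix.diagonal dV) (Matrix.diagonal dW)}
  (hg₀ : ((g₀ : GL (Fin N × Fin M) L) : Matrix (Fin N × Fin M) (Fin N × Fin M) L) = Matrix.diagonal (fun k => 1 - 2 * (![0, 1] : Fin 2 → L) (e k)))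

variable (Λ : GL (Fin 2) (AdeleRing (𝓞 L) L) →* HA L e dV hdV dW hdW)
  (hΛ : ∀ g : GL (Fin 2) (AdeleRing (𝓞 L) L), blk L e dV hdV dW hdW (Λ g) =
    cayR (AdeleRing (𝓞 L) L) (Fin 2) * Matrix.fromBlocks (g : Matrix (Fin 2) (Fin 2) (AdeleRing (𝓞 L) L)) 0 0
      (((gramR L e dV hdV dW hdW).map ((algebraMap L (AdeleRing (𝓞 L) L)).comp (algebraMap (Fp L) L)))⁻¹ *
        (((g⁻¹ : GL (Fin 2) (AdeleRing (𝓞 L) L)) : Matrix (Fin 2) (Fin 2) (AdeleRing (𝓞 L) L)).map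
          (conjAdele (Fp L) L (IsCMField.complexConj L)))ᵀ *
        (gramR L e dV hdV dW hdW).map ((algebraMap L (AdeleRing (𝓞 L) L)).comp (algebraMap (Fp L) L))) *
      cayRinv (AdeleRing (𝓞 L) L) (Fin 2))

include hg₀ hΛ in
/-- **THE `Δ`-BLOCK OF `w₀ · Λ(x) · w₀`**: `deltaBlock (w₀ Λ(x) w₀) = x − (x − x♯)·diag(0,1)` for every `x ∈ GL₂(𝔸_L)`, `x♯ = T⁻¹ (x̄⁻¹)ᵀ T` — the first column of `x` and the
second column of `x♯` (★ `deltaBlock_eq_conj`, ★ `conj_blk_mul`, ★ `frame_iotaGG_signInvolution`, ★ `frame_levi_apply`, §1).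
[cite: MoeglinWaldspurger1995, II.1.7] [cite: GelbartPiatetskishapiroRallis1987, Part A §§1–2] -/
theorem deltaBlock_reflStd_conj_levi (x : GL (Fin 2) (AdeleRing (𝓞 L) L)) :
    deltaBlock L e dV hdV dW hdW
        (iotaGG L e dV hdV dW hdW (1, UnitaryGroup.rationalPairToAdelic (Fp L) L (IsCMField.complexConj L) N M (Matrix.diagonal dV) (Matrix.diagonal dW) g₀) *
          Λ x *
          iotaGG L e dV hdV dW hdW (1, UnitaryGroup.rationalPairToAdelic (Fp L) L (IsCMField.complexConj L) N M (Matrix.diagonal dV) (Matrix.diagonal dW) g₀)) =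
      (x : Matrix (Fin 2) (Fin 2) (AdeleRing (𝓞 L) L)) -
        ((x : Matrix (Fin 2) (Fin 2) (AdeleRing (𝓞 L) L)) -
          ((gramR L e dV hdV dW hdW).map ((algebraMap L (AdeleRing (𝓞 L) L)).comp (algebraMap (Fp L) L)))⁻¹ *
            (((x⁻¹ : GL (Fin 2) (AdeleRing (𝓞 L) L)) : Matrix (Fin 2) (Fin 2) (AdeleRing (𝓞 L) L)).map
              (conjAdele (Fp L) L (IsCMField.complexConj L)))ᵀ *
            (gramR L e dV hdV dW hdW).map ((algebraMap L (AdeleRing (𝓞 L) L)).comp (algebraMap (Fp L) L))) *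
        Matrix.diagonal (![0, 1] : Fin 2 → AdeleRing (𝓞 L) L) := by
  rw [deltaBlock_eq_conj, conj_blk_mul, conj_blk_mul, frame_iotaGG_signInvolution L e dV hdV dW hdW (![0, 1] : Fin 2 → L) hg₀,
    frame_levi_apply L e dV hdV dW hdW Λ hΛ x, algebraMap_pattern_std, toBlocks₁₁_frame_conj_levi, Matrix.smul_mul, Matrix.mul_smul, smul_smul,
    invOf_mul_self, one_smul]

include hg₀ hΛ in
/-- **`det_Δ (w₀ Λ(x) w₀) = x₀₀ · x♯₁₁ − x♯₀₁ · x₁₀`** (the `2 × 2` determinant of the columns `(x·e₀ | x♯·e₁)`); on the Siegel locus `x₁₀ = 0 = x♯₀₁` this is `x₀₀ · x♯₁₁`.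
[cite: MoeglinWaldspurger1995, II.1.7] [cite: GelbartPiatetskishapiroRallis1987, Part A §§1–2] -/
theorem detDelta_reflStd_conj_levi (x : GL (Fin 2) (AdeleRing (𝓞 L) L)) :
    detDelta L e dV hdV dW hdW
        (iotaGG L e dV hdV dW hdW (1, UnitaryGroup.rationalPairToAdelic (Fp L) L (IsCMField.complexConj L) N M (Matrix.diagonal dV) (Matrix.diagonal dW) g₀) *
          Λ x *
          iotaGG L e dV hdV dW hdW (1, UnitaryGroup.rationalPairToAdelic (Fp L) L (IsCMField.complexConj L) N M (Matrix.diagonal dV) (Matrix.diagonal dW) g₀)) =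
      (x : Matrix (Fin 2) (Fin 2) (AdeleRing (𝓞 L) L)) 0 0 *
          (((gramR L e dV hdV dW hdW).map ((algebraMap L (AdeleRing (𝓞 L) L)).comp (algebraMap (Fp L) L)))⁻¹ *
            (((x⁻¹ : GL (Fin 2) (AdeleRing (𝓞 L) L)) : Matrix (Fin 2) (Fin 2) (AdeleRing (𝓞 L) L)).map
              (conjAdele (Fp L) L (IsCMField.complexConj L)))ᵀ *
            (gramR L e dV hdV dW hdW).map ((algebraMap L (AdeleRing (𝓞 L) L)).comp (algebraMap (Fp L) L))) 1 1 -
        (((gramR L e dV hdV dW hdW).map ((algebraMap L (AdeleRing (𝓞 L) L)).comp (algebraMap (Fp L) L)))⁻¹ *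
            (((x⁻¹ : GL (Fin 2) (AdeleRing (𝓞 L) L)) : Matrix (Fin 2) (Fin 2) (AdeleRing (𝓞 L) L)).map
              (conjAdele (Fp L) L (IsCMField.complexConj L)))ᵀ *
            (gramR L e dV hdV dW hdW).map ((algebraMap L (AdeleRing (𝓞 L) L)).comp (algebraMap (Fp L) L))) 0 1 *
          (x : Matrix (Fin 2) (Fin 2) (AdeleRing (𝓞 L) L)) 1 0 := by
  unfold detDelta
  rw [deltaBlock_reflStd_conj_levi L e dV hdV dW hdW hg₀ Λ hΛ x, Matrix.det_fin_two]
  simp [Matrix.mul_apply, Fin.sum_univ_two, Matrix.diagonal_apply]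

end Doubled

end Summit.HodgeConjecture.HodgeConjecture.Cruxes.HLiu418.K2LiuReflStdLeviConjDeltaBlock

end
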